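import Literature.Probability.LatticeModels.KasteleynMatrix
import Mathlib.Data.Pi.Interval
import Mathlib.Data.Int.Interval
import HarnessLib

/-!
# Lattice boxes are simply connected skeleta: Kasteleyn's theorem applies to rectangles

Topic `Literature/Probability/LatticeModels`, companion of `KasteleynMatrix.lean` (definition item
`defn-kasteleynMatrix`). PROVED here: for `a b : Site 2` with `a i < b i` (`i = 0, 1`), the
nearest-neighbour graph `zdGraph 2` on the box `Finset.Icc a b` (all lattice points of the closed
rectangle `[a₀, b₀] × [a₁, b₁]`, at least `2 × 2` of them) is the 1-skeleton of the union of the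
unit faces with lower-left corners in `Finset.Icc a (b - 1)` (`isFaceSkeleton_Icc`), whose union is
the filled rectangle `closedBox a b ⊆ ℂ` (`faceUnion_Icc`), convex hence simply connected; so
`isSimplyConnectedSkeleton_Icc : IsSimplyConnectedSkeleton (zdGraph 2) (Finset.Icc a b)` — the
hypothesis of Kenyon 1997 Thm 2 / Prop 5 (`Kenyon1997_prop5`) in the original setting of
Kasteleyn (1961) and Temperley–Fisher (1961), domino tilings of an `m × n` rectangle — and
`norm_det_kasteleynMatrix_Icc : ‖det K_{[a,b]}‖ = (#domino tilings)²` from the named fact.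
The closed-form product formula of Kasteleyn / Temperley–Fisher for that number is NOT stated here.

Sources: [Kenyon1997] §2.1 ("Kasteleyn [Kast1] and Temperley and Fisher [TF] independently
computed the number of perfect matchings of an `m × n` grid"), Thm 2; P. W. Kasteleyn, Physica 27
(1961) 1209–1225; H. N. V. Temperley, M. E. Fisher, Phil. Mag. 6 (1961) 1061–1063 (cited through
[Kenyon1997]).
-/

noncomputable section

open scoped Classical

namespace Literature.Probability.LatticeModels

open Finset Matrix

/-! ### Rectangles: the lattice box `[a, b] ∩ ℤ²` is a simply connected skeleton -/

section Rectangle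

variable {a b : Site 2}

/-- Coordinates of `b - 1` (local helper). [folklore] -/
theorem site_sub_one_apply (b : Site 2) (i : Fin 2) : (b - 1) i = b i - 1 := rfl

/-- Membership in a lattice box, coordinatewise (local copy of the tree's `mem_siteIcc_iff` /
`mem_Icc_site_iff_forall`, whose home files carry heavy imports). [folklore] -/
theorem mem_Icc_site_iff_forall {a b x : Site 2} :
    x ∈ Finset.Icc a b ↔ ∀ i, a i ≤ x i ∧ x i ≤ b i := by
  rw [Finset.mem_Icc, Pi.le_def, Pi.le_def, ← forall_and]

/-- Membership in a lattice face, as a list of four alternatives. [folklore] -/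
theorem mem_latticeFace {c x : Site 2} :
    x ∈ latticeFace c ↔ x = c ∨ x = c + Pi.single 0 1 ∨ x = c + Pi.single 1 1 ∨
      x = c + Pi.single 0 1 + Pi.single 1 1 := by
  simp [latticeFace]

/-- The lower-left corner of a face of the box containing the site `x` of the box: clamp each
coordinate to `[a i, b i - 1]`. [folklore] -/
def boxFaceOf (b x : Site 2) : Site 2 := fun i => if x i < b i then x i else x i - 1

/-- `boxFaceOf` lands in the face index set of the box. [folklore] -/
theorem boxFaceOf_mem (hab : ∀ i, a i < b i) {x : Site 2} (hx : x ∈ Finset.Icc a b) :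
    boxFaceOf b x ∈ Finset.Icc a (b - 1) := by
  rw [mem_Icc_site_iff_forall] at hx ⊢
  intro i
  rw [site_sub_one_apply]
  unfold boxFaceOf
  have := hx i
  have := hab i
  split_ifs <;> omega

/-- Every site of the box is a corner of its clamped face. [folklore] -/
theorem mem_latticeFace_boxFaceOf {x : Site 2} (hx : x ∈ Finset.Icc a b) :
    x ∈ latticeFace (boxFaceOf b x) := by
  rw [mem_Icc_site_iff_forall] at hx
  rw [mem_latticeFace]
  have h0 := hx 0
  have h1 := hx 1
  by_cases c0 : x 0 < b 0 <;> by_cases c1 : x 1 < b 1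
  · left; funext i; fin_cases i <;> simp [boxFaceOf, c0, c1]
  · right; right; left; funext i; fin_cases i <;> simp [boxFaceOf, c0, c1]
  · right; left; funext i; fin_cases i <;> simp [boxFaceOf, c0, c1]
  · right; right; right; funext i; fin_cases i <;> simp [boxFaceOf, c0, c1]

/-- The corners of the faces indexed by `[a, b - 1]` lie in the box `[a, b]`. [folklore] -/
theorem mem_Icc_of_mem_latticeFace {c x : Site 2} (hc : c ∈ Finset.Icc a (b - 1))
    (hx : x ∈ latticeFace c) : x ∈ Finset.Icc a b := by
  rw [mem_Icc_site_iff_forall] at hc ⊢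
  rw [mem_latticeFace] at hx
  have hc0 := hc 0
  have hc1 := hc 1
  rw [site_sub_one_apply] at hc0 hc1
  intro i
  rcases hx with rfl | rfl | rfl | rfl <;> fin_cases i <;> simp <;> omega

/-- **The box is the union of its faces' corners.** [folklore] -/
theorem Icc_eq_biUnion_latticeFace (hab : ∀ i, a i < b i) :
    Finset.Icc a b = (Finset.Icc a (b - 1)).biUnion latticeFace := by
  ext x
  rw [Finset.mem_biUnion]
  constructor
  · exact fun hx => ⟨boxFaceOf b x, boxFaceOf_mem hab hx, mem_latticeFace_boxFaceOf hx⟩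
  · rintro ⟨c, hc, hx⟩
    exact mem_Icc_of_mem_latticeFace hc hx

/-- **Every lattice bond of the box is a side of a face of the box** (this needs `a i < b i`:
a degenerate box `a 0 = b 0` is a path, not a union of faces). [folklore] -/
theorem exists_face_of_adj (hab : ∀ i, a i < b i) {x y : Site 2} (hx : x ∈ Finset.Icc a b)
    (hy : y ∈ Finset.Icc a b) (hxy : (zdGraph 2).Adj x y) :
    ∃ c ∈ Finset.Icc a (b - 1), x ∈ latticeFace c ∧ y ∈ latticeFace c := by
  -- reduce to `y = x + eᵢ`
  wlog h : ∃ i, y = x + Pi.single i 1 generalizing x y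
  · obtain ⟨i, hi | hi⟩ := (zdGraph_adj_iff x y).1 hxy
    · exact this hx hy hxy ⟨i, hi⟩
    · obtain ⟨c, hc, h1, h2⟩ := this hy hx hxy.symm ⟨i, hi⟩
      exact ⟨c, hc, h2, h1⟩
  obtain ⟨i, rfl⟩ := h
  rw [mem_Icc_site_iff_forall] at hx hy
  have hx0 := hx 0; have hx1 := hx 1; have hy0 := hy 0; have hy1 := hy 1
  fin_cases i
  · -- horizontal bond: face column `x 0`, row clamped
    simp only [Fin.zero_eta, Pi.add_apply, Pi.single_eq_same, Fin.isValue, ne_eq,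
      one_ne_zero, not_false_eq_true, Pi.single_eq_of_ne] at hy0 hy1
    refine ⟨fun j => if j = 0 then x 0 else (if x 1 < b 1 then x 1 else x 1 - 1), ?_, ?_, ?_⟩
    · rw [mem_Icc_site_iff_forall]
      intro j
      rw [site_sub_one_apply]
      have := hab 1
      fin_cases j <;> simp <;> (try split_ifs) <;> omega
    · rw [mem_latticeFace]
      by_cases c1 : x 1 < b 1
      · left; funext j; fin_cases j <;> simp [c1]
      · right; right; left; funext j; fin_cases j <;> simp [c1]
    · rw [mem_latticeFace]
      by_cases c1 : x 1 < b 1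
      · right; left; funext j; fin_cases j <;> simp [c1]
      · right; right; right; funext j; fin_cases j <;> simp [c1]
  · -- vertical bond: face row `x 1`, column clamped
    simp only [Fin.mk_one, Pi.add_apply, Fin.isValue, ne_eq, zero_ne_one, not_false_eq_true,
      Pi.single_eq_of_ne, Pi.single_eq_same] at hy0 hy1
    refine ⟨fun j => if j = 0 then (if x 0 < b 0 then x 0 else x 0 - 1) else x 1, ?_, ?_, ?_⟩
    · rw [mem_Icc_site_iff_forall]
      intro j
      rw [site_sub_one_apply]
      have := hab 0
      fin_cases j <;> simp <;> (try split_ifs) <;> omega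
    · rw [mem_latticeFace]
      by_cases c0 : x 0 < b 0
      · left; funext j; fin_cases j <;> simp [c0]
      · right; left; funext j; fin_cases j <;> simp [c0]
    · rw [mem_latticeFace]
      by_cases c0 : x 0 < b 0
      · right; right; left; funext j; fin_cases j <;> simp [c0]
      · right; right; right; funext j; fin_cases j <;> simp [c0]

/-- **The nearest-neighbour graph on a box is the 1-skeleton of the union of its faces.**
[folklore] -/
theorem isFaceSkeleton_Icc (hab : ∀ i, a i < b i) :
    IsFaceSkeleton (zdGraph 2) (Finset.Icc a b) (Finset.Icc a (b - 1)) where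
  eq_biUnion := Icc_eq_biUnion_latticeFace hab
  adj_iff := fun _ _ hx hy =>
    ⟨fun h => ⟨h, exists_face_of_adj hab hx hy h⟩, fun h => h.1⟩

/-- The filled rectangle `[a₀, b₀] × [a₁, b₁] ⊆ ℂ`. [folklore] -/
def closedBox (a b : Site 2) : Set ℂ :=
  {z | (a 0 : ℝ) ≤ z.re ∧ z.re ≤ b 0 ∧ (a 1 : ℝ) ≤ z.im ∧ z.im ≤ b 1}

/-- **The union of the faces of a box is the filled rectangle.** [folklore] -/
theorem faceUnion_Icc (hab : ∀ i, a i < b i) : faceUnion (Finset.Icc a (b - 1)) = closedBox a b := by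
  ext z
  rw [mem_faceUnion]
  constructor
  · rintro ⟨c, hc, hz⟩
    rw [mem_Icc_site_iff_forall] at hc
    have hc0 := hc 0; have hc1 := hc 1
    rw [site_sub_one_apply] at hc0 hc1
    obtain ⟨h1, h2, h3, h4⟩ := hz
    have e0 : ((c 0 : ℤ) : ℝ) + 1 ≤ b 0 := by exact_mod_cast (show c 0 + 1 ≤ b 0 by omega)
    have e1 : ((c 1 : ℤ) : ℝ) + 1 ≤ b 1 := by exact_mod_cast (show c 1 + 1 ≤ b 1 by omega)
    have e2 : ((a 0 : ℤ) : ℝ) ≤ c 0 := by exact_mod_cast hc0.1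
    have e3 : ((a 1 : ℤ) : ℝ) ≤ c 1 := by exact_mod_cast hc1.1
    exact ⟨by linarith, by linarith, by linarith, by linarith⟩
  · rintro ⟨h1, h2, h3, h4⟩
    refine ⟨fun i => if i = 0 then min ⌊z.re⌋ (b 0 - 1) else min ⌊z.im⌋ (b 1 - 1), ?_, ?_⟩
    · rw [mem_Icc_site_iff_forall]
      intro i
      rw [site_sub_one_apply]
      have f0 : a 0 ≤ ⌊z.re⌋ := Int.le_floor.2 h1
      have f1 : a 1 ≤ ⌊z.im⌋ := Int.le_floor.2 h3
      have := hab 0; have := hab 1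
      fin_cases i <;> simp <;> omega
    · have r0 := Int.floor_le z.re
      have r1 := Int.lt_floor_add_one z.re
      have i0 := Int.floor_le z.im
      have i1 := Int.lt_floor_add_one z.im
      refine ⟨?_, ?_, ?_, ?_⟩ <;>
        simp only [Fin.isValue, ↓reduceIte, one_ne_zero]
      · rcases min_cases ⌊z.re⌋ (b 0 - 1) with ⟨h, -⟩ | ⟨h, hlt⟩ <;> rw [h]
        · exact r0
        · have hlt' : ((b 0 : ℤ) : ℝ) - 1 < ⌊z.re⌋ := by exact_mod_cast hlt
          push_cast; linarith
      · rcases min_cases ⌊z.re⌋ (b 0 - 1) with ⟨h, hle⟩ | ⟨h, -⟩ <;> rw [h]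
        · linarith
        · push_cast; linarith
      · rcases min_cases ⌊z.im⌋ (b 1 - 1) with ⟨h, -⟩ | ⟨h, hlt⟩ <;> rw [h]
        · exact i0
        · have hlt' : ((b 1 : ℤ) : ℝ) - 1 < ⌊z.im⌋ := by exact_mod_cast hlt
          push_cast; linarith
      · rcases min_cases ⌊z.im⌋ (b 1 - 1) with ⟨h, hle⟩ | ⟨h, -⟩ <;> rw [h]
        · linarith
        · push_cast; linarith

/-- The filled rectangle is convex. [folklore] -/
theorem convex_closedBox (a b : Site 2) : Convex ℝ (closedBox a b) := by
  have h : closedBox a b = {z : ℂ | (a 0 : ℝ) ≤ z.re} ∩ {z : ℂ | z.re ≤ (b 0 : ℝ)} ∩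
      {z : ℂ | (a 1 : ℝ) ≤ z.im} ∩ {z : ℂ | z.im ≤ (b 1 : ℝ)} := by
    ext z; simp [closedBox, and_assoc]
  rw [h]
  exact (((convex_halfSpace_re_ge _).inter (convex_halfSpace_re_le _)).inter
    (convex_halfSpace_im_ge _)).inter (convex_halfSpace_im_le _)

/-- **Boxes are simply connected skeleta** (the setting of Kasteleyn 1961 and Temperley–Fisher
1961: domino tilings of an `m × n` rectangle; here `m = b 0 - a 0 + 1`, `n = b 1 - a 1 + 1` sites,
both `≥ 2`). [folklore] -/
theorem isSimplyConnectedSkeleton_Icc (hab : ∀ i, a i < b i) :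
    IsSimplyConnectedSkeleton (zdGraph 2) (Finset.Icc a b) := by
  refine ⟨Finset.Icc a (b - 1), isFaceSkeleton_Icc hab, ?_⟩
  rw [faceUnion_Icc hab]
  refine isSimplyConnected_of_convex (convex_closedBox a b) ⟨Site.toComplex a, ?_⟩
  have h0 : ((a 0 : ℤ) : ℝ) ≤ b 0 := by exact_mod_cast (hab 0).le
  have h1 : ((a 1 : ℤ) : ℝ) ≤ b 1 := by exact_mod_cast (hab 1).le
  exact ⟨le_rfl, h0, le_rfl, h1⟩

/-- **Kasteleyn's theorem for rectangles (Kasteleyn 1961; Temperley–Fisher 1961; as an instance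
of Kenyon 1997 Thm 2), from `Kenyon1997_prop5`:** for the nearest-neighbour graph on a lattice box
with at least two sites in each direction, `|det K| = (number of domino tilings)²`.
[cite: Kenyon1997, Thm 2 and §2.1 (Kasteleyn; Temperley–Fisher: the m × n grid)] -/
theorem norm_det_kasteleynMatrix_Icc (h : Kenyon1997_prop5) (hab : ∀ i, a i < b i) :
    ‖(kasteleynMatrix (zdGraph 2) (Finset.Icc a b)).det‖ =
      (perfectMatchingCount (zdGraph 2) (↑(Finset.Icc a b) : Set (Site 2)) : ℝ) ^ 2 :=
  kenyon1997_thm2 h (isSimplyConnectedSkeleton_Icc hab)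

end Rectangle

end Literature.Probability.LatticeModels

end
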